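import Literature.Geometry.Symplectic.JHolomorphicLocalIntersections
import Literature.Geometry.Symplectic.JHolomorphicIntersectionPersistFlat
import Literature.Geometry.Symplectic.JHolomorphicChartLocalisation
import Literature.Geometry.Symplectic.JHolomorphicWeierstrass
import Literature.Geometry.Symplectic.JHolomorphicWeierstrassProofs
import HarnessLib

/-!
# Positivity of intersections, persistence form (McDuff 1991, Thm 1.1) — the manifold statement

Proof of the named fact `Literature.Geometry.Symplectic.jHolomorphic_isolatedIntersection_persists`
(F4 of `Literature/Geometry/Symplectic/JHolomorphicLocalIntersections.lean`; D. McDuff, *The local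
behaviour of holomorphic curves in almost complex 4-manifolds*, JDG 34 (1991), Thm 1.1 with §5
(5.1) cases (i)–(ii) and Lemma 4.2(ii)/4.3) from

* its flat single-chart form `Literature.Geometry.Symplectic.isolatedIntersection_persists_flat`
  (`JHolomorphicIntersectionPersistFlat.lean`: sheet chart + similarity principle give a positive
  local index, and zeros of the normal coordinate persist once the first family of approximants
  is `C¹`-close), and
* the generalized Weierstraß theorem for `J`-holomorphic maps
  `Literature.Geometry.Symplectic.JHolomorphicWeierstrassR4` (Hummel 1997, III.3.1: `C⁰`-convergent
  `J`-holomorphic maps converge in `C¹`), which supplies the `C¹`-closeness of the approximants of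
  the regular branch from the `C⁰`-closeness in the statement (McDuff's Lemma 4.3 is stated for
  `C¹`-close maps);

via the chart localisation of `Literature/Geometry/Symplectic/JHolomorphicChartLocalisation.lean`:
read everything in the extended chart `φ₀` at the intersection point `x₀ = G₂ 0`, where `J`
becomes a smooth coordinate structure `Jc` on the chart target (globalised to a smooth almost
complex structure `Jg` on `ℝ⁴` agreeing with `Jc` near `φ₀ x₀`), the curves become flat
`Jc`-holomorphic maps (globalised by cut-off), the isolation hypothesis transfers because `φ₀` is
injective on the chart domain, and uniform convergence of the approximants through the auxiliary
embedding `ι : V → ℝᴺ` becomes uniform convergence in the chart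
(`ChartLocalisation.tendstoUniformlyOn_chart_of_isEmbedding`).

* `jHolomorphic_isolatedIntersection_persists_of_weierstrass :
    JHolomorphicWeierstrassR4 → jHolomorphic_isolatedIntersection_persists`;
* `jHolomorphic_isolatedIntersection_persists_holds` — the DISCHARGE of the named fact, from the
  reduction and `Literature.Geometry.Symplectic.JHolomorphicWeierstrassR4_holds`
  (`Literature/Geometry/Symplectic/JHolomorphicWeierstrassProofs.lean`).

## References

* D. McDuff, *The local behaviour of holomorphic curves in almost complex 4-manifolds*,
  J. Differential Geom. 34 (1991) 143–164, Thm 1.1, Lemma 4.2, Lemma 4.3, §5 (5.1).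
  [McDuff1991LocalBehaviour]
* C. Hummel, *Gromov's Compactness Theorem for Pseudo-holomorphic Curves* (1997), Ch. III,
  Prop. 3.1. [Hummel1997]
-/

noncomputable section

open scoped Manifold ContDiff Topology
open Set Filter Metric Function
open Literature.Geometry.Symplectic.ChartLocalisation
  Literature.Geometry.Symplectic.IntersectionPersist

namespace Literature.Geometry.Symplectic

/-- **Positivity of intersections, persistence form (McDuff 1991, Thm 1.1, §5 (5.1)(i)–(ii),
Lemma 4.2(ii)), from the generalized Weierstraß theorem.** Assuming the `C⁰ ⇒ C¹` upgrade for
convergent `J`-holomorphic maps (`JHolomorphicWeierstrassR4`, Hummel 1997 III.3.1), an isolated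
intersection of two smooth `J`-holomorphic branches `G₁, G₂ : ℂ → V` in an almost complex
`4`-manifold, `G₂` regular at the point, persists under `C⁰`-small perturbation by
`J`-holomorphic maps: the named fact `jHolomorphic_isolatedIntersection_persists` holds.
[cite: McDuff1991LocalBehaviour, Thm 1.1, §5 (5.1)(i)-(ii), Lemma 4.2(ii)] -/
theorem jHolomorphic_isolatedIntersection_persists_of_weierstrass (hW : JHolomorphicWeierstrassR4) :
    jHolomorphic_isolatedIntersection_persists := by
  intro V _ _ _ _ _ J hJ2 hJsm N ι hι _hιs _hιi G₁ G₂ hG₁ hG₁J hG₂ hG₂J h0 hreg ρ hρ hiso u v hu huJ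
    hv hvJ hcu hcv
  -- the chart at the intersection point and the coordinate structure on its target
  haveI : LocallyCompactSpace V := ChartedSpace.locallyCompactSpace (EuclideanSpace ℝ (Fin 4)) V
  set x₀ : V := G₂ 0 with hx₀_def
  obtain ⟨Jc, hJc, hJc2, hJcJ⟩ := exists_chartJ J hJ2 hJsm x₀
  set φ := extChartAt (𝓡 4) x₀ with hφ_def
  set S : Set V := (chartAt (EuclideanSpace ℝ (Fin 4)) x₀).source with hS_def
  have hSo : IsOpen S := (chartAt (EuclideanSpace ℝ (Fin 4)) x₀).open_source
  have hx₀S : x₀ ∈ S := mem_chart_source (EuclideanSpace ℝ (Fin 4)) x₀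
  have hSsrc : S = φ.source := by rw [hφ_def, extChartAt_source]
  have hTo : IsOpen φ.target := isOpen_extChartAt_target x₀
  have hφS : ∀ x ∈ S, φ x ∈ φ.target := fun x hx => φ.map_source (by rwa [← hSsrc])
  have hφinj : InjOn φ S := by rw [hSsrc]; exact φ.injOn
  have hφc : ContinuousOn φ S := by rw [hSsrc]; exact continuousOn_extChartAt x₀
  set y₀ : EuclideanSpace ℝ (Fin 4) := φ x₀ with hy₀_def
  have hy₀T : y₀ ∈ φ.target := hφS x₀ hx₀S
  -- the chart representatives of the two branches
  set g₁ : ℂ → EuclideanSpace ℝ (Fin 4) := fun z => φ (G₁ z) with hg₁_def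
  set g₂ : ℂ → EuclideanSpace ℝ (Fin 4) := fun z => φ (G₂ z) with hg₂_def
  have hg₂0 : g₂ 0 = y₀ := rfl
  have hg₁0 : g₁ 0 = y₀ := by simp only [hg₁_def, h0, hy₀_def, hx₀_def]
  -- a radius on which both branches stay in the chart domain
  obtain ⟨ρa, hρa, hρaS⟩ : ∃ ρa : ℝ, 0 < ρa ∧ ∀ z ∈ ball (0 : ℂ) ρa, G₁ z ∈ S ∧ G₂ z ∈ S := by
    have h1 : ∀ᶠ z in 𝓝 (0 : ℂ), G₁ z ∈ S :=
      hG₁.continuous.continuousAt.eventually_mem (hSo.mem_nhds (by rw [h0]; exact hx₀S))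
    have h2 : ∀ᶠ z in 𝓝 (0 : ℂ), G₂ z ∈ S :=
      hG₂.continuous.continuousAt.eventually_mem (hSo.mem_nhds hx₀S)
    obtain ⟨r, hr, hrb⟩ := Metric.eventually_nhds_iff_ball.1 (h1.and h2)
    exact ⟨r, hr, hrb⟩
  -- smoothness and flat holomorphicity of the representatives, regularity of `g₂` at `0`
  have hg₁s : ContDiffOn ℝ ∞ g₁ (ball 0 ρa) := fun z hz =>
    (contDiffAt_chart (hG₁ z) (hρaS z hz).1).contDiffWithinAt
  have hg₂s : ContDiffOn ℝ ∞ g₂ (ball 0 ρa) := fun z hz =>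
    (contDiffAt_chart (hG₂ z) (hρaS z hz).2).contDiffWithinAt
  have hg₁J : ∀ z ∈ ball (0 : ℂ) ρa, ∀ ζ : ℂ,
      fderiv ℝ g₁ z (Complex.I * ζ) = Jc (g₁ z) (fderiv ℝ g₁ z ζ) := fun z hz ζ => by
    rw [show g₁ z = φ (G₁ z) from rfl, hJcJ _ (hρaS z hz).1]
    exact fderiv_chart_I_mul J (hG₁ z) (hG₁J z) (hρaS z hz).1 ζ
  have hg₂J : ∀ z ∈ ball (0 : ℂ) ρa, ∀ ζ : ℂ,
      fderiv ℝ g₂ z (Complex.I * ζ) = Jc (g₂ z) (fderiv ℝ g₂ z ζ) := fun z hz ζ => by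
    rw [show g₂ z = φ (G₂ z) from rfl, hJcJ _ (hρaS z hz).2]
    exact fderiv_chart_I_mul J (hG₂ z) (hG₂J z) (hρaS z hz).2 ζ
  have hinj0 : Injective (fderiv ℝ g₂ 0) :=
    injective_fderiv_chart (hG₂ 0) (hρaS 0 (mem_ball_self hρa)).2 hreg
  -- globalisation: `Jg` a global smooth almost complex structure, `bg, vg` globally smooth
  obtain ⟨Jg, hJg, hJg2, rJ, hrJ, -, hJgc⟩ := exists_contDiff_sq_neg_eqOn_ball hTo hJc hJc2 hy₀T
  obtain ⟨bg, hbg, rb, hrb, hrbρa, hbg₂⟩ :=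
    exists_contDiff_eqOn_ball isOpen_ball hg₂s (mem_ball_self hρa)
  obtain ⟨vg, hvg, rv, hrv, hrvρa, hvg₁⟩ :=
    exists_contDiff_eqOn_ball isOpen_ball hg₁s (mem_ball_self hρa)
  -- a radius `R` on which the globalised data agree with the chart data near `y₀`
  obtain ⟨R, hR, hRb, hRv, hRJ⟩ : ∃ R : ℝ, 0 < R ∧ R ≤ rb ∧ R ≤ rv ∧
      ∀ z ∈ ball (0 : ℂ) R, g₁ z ∈ ball y₀ rJ ∧ g₂ z ∈ ball y₀ rJ := by
    have hc1 : ContinuousAt g₁ 0 :=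
      hg₁s.continuousOn.continuousAt (isOpen_ball.mem_nhds (mem_ball_self hρa))
    have hc2 : ContinuousAt g₂ 0 :=
      hg₂s.continuousOn.continuousAt (isOpen_ball.mem_nhds (mem_ball_self hρa))
    have h1 : ∀ᶠ z in 𝓝 (0 : ℂ), g₁ z ∈ ball y₀ rJ :=
      hc1.eventually_mem (isOpen_ball.mem_nhds (by rw [hg₁0]; exact mem_ball_self hrJ))
    have h2 : ∀ᶠ z in 𝓝 (0 : ℂ), g₂ z ∈ ball y₀ rJ :=
      hc2.eventually_mem (isOpen_ball.mem_nhds (by rw [hg₂0]; exact mem_ball_self hrJ))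
    obtain ⟨r, hr, hrb'⟩ := Metric.eventually_nhds_iff_ball.1 (h1.and h2)
    exact ⟨min r (min rb rv), lt_min hr (lt_min hrb hrv),
      (min_le_right _ _).trans (min_le_left _ _), (min_le_right _ _).trans (min_le_right _ _),
      fun z hz => hrb' z (ball_subset_ball (min_le_left _ _) hz)⟩
  have hRb' : ball (0 : ℂ) R ⊆ ball 0 rb := ball_subset_ball hRb
  have hRv' : ball (0 : ℂ) R ⊆ ball 0 rv := ball_subset_ball hRv
  have hRa : ball (0 : ℂ) R ⊆ ball 0 ρa := hRb'.trans hrbρa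
  -- the hypotheses of the flat theorem for `(Jg, bg, vg)` on `ball 0 R`
  have hbJ' : ∀ z ∈ ball (0 : ℂ) R, ∀ α : ℂ,
      fderiv ℝ bg z (Complex.I * α) = Jg (bg z) (fderiv ℝ bg z α) := fun z hz α => by
    rw [(hbg₂.eventuallyEq_of_mem (isOpen_ball.mem_nhds (hRb' hz))).fderiv_eq, hbg₂ (hRb' hz),
      hJgc (hRJ z hz).2]
    exact hg₂J z (hRa hz) α
  have hvJ' : ∀ z ∈ ball (0 : ℂ) R, ∀ α : ℂ,
      fderiv ℝ vg z (Complex.I * α) = Jg (vg z) (fderiv ℝ vg z α) := fun z hz α => by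
    rw [(hvg₁.eventuallyEq_of_mem (isOpen_ball.mem_nhds (hRv' hz))).fderiv_eq, hvg₁ (hRv' hz),
      hJgc (hRJ z hz).1]
    exact hg₁J z (hRa hz) α
  have hJ2' : ∀ z ∈ ball (0 : ℂ) R, ∀ x : EuclideanSpace ℝ (Fin 4),
      Jg (bg z) (Jg (bg z) x) = -x := fun z _ x => hJg2 _ x
  have hinj' : Injective (fderiv ℝ bg 0) := by
    rw [(hbg₂.eventuallyEq_of_mem (isOpen_ball.mem_nhds (mem_ball_self hrb))).fderiv_eq]
    exact hinj0
  have hx' : vg 0 = bg 0 := by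
    rw [hvg₁ (mem_ball_self hrv), hbg₂ (mem_ball_self hrb), hg₁0]
  set ρi : ℝ := min R ρ with hρi_def
  have hρi : 0 < ρi := lt_min hR hρ
  have hiso' : ∀ s ∈ ball (0 : ℂ) ρi, ∀ t ∈ ball (0 : ℂ) ρi, vg s = bg t → s = 0 ∧ t = 0 := by
    intro s hs t ht hst
    have hsR : s ∈ ball (0 : ℂ) R := ball_subset_ball (min_le_left _ _) hs
    have htR : t ∈ ball (0 : ℂ) R := ball_subset_ball (min_le_left _ _) ht
    rw [hvg₁ (hRv' hsR), hbg₂ (hRb' htR)] at hst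
    have heq : G₁ s = G₂ t := hφinj (hρaS s (hRa hsR)).1 (hρaS t (hRa htR)).2 hst
    exact hiso s (ball_subset_ball (min_le_right _ _) hs) t
      (ball_subset_ball (min_le_right _ _) ht) heq
  -- the approximants read in the chart: `C⁰`-convergence on `closedBall 0 ρc`
  set ρc : ℝ := ρi / 2 with hρc_def
  have hρc : 0 < ρc := half_pos hρi
  have hρcR : closedBall (0 : ℂ) ρc ⊆ ball 0 R :=
    closedBall_subset_ball ((half_lt_self hρi).trans_le (min_le_left _ _))
  have hρcρ : closedBall (0 : ℂ) ρc ⊆ closedBall 0 ρ :=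
    closedBall_subset_closedBall ((half_lt_self hρi).le.trans (min_le_right _ _))
  have hρcρ' : ρc < ρ := (half_lt_self hρi).trans_le (min_le_right _ _)
  have hK₁c : IsCompact (G₁ '' closedBall (0 : ℂ) ρc) :=
    (isCompact_closedBall 0 ρc).image hG₁.continuous
  have hK₂c : IsCompact (G₂ '' closedBall (0 : ℂ) ρc) :=
    (isCompact_closedBall 0 ρc).image hG₂.continuous
  have hK₁S : G₁ '' closedBall (0 : ℂ) ρc ⊆ S := by
    rintro _ ⟨z, hz, rfl⟩
    exact (hρaS z (hRa (hρcR hz))).1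
  have hK₂S : G₂ '' closedBall (0 : ℂ) ρc ⊆ S := by
    rintro _ ⟨z, hz, rfl⟩
    exact (hρaS z (hRa (hρcR hz))).2
  obtain ⟨hTu, hevu⟩ := tendstoUniformlyOn_chart_of_isEmbedding hι hSo hφc hK₁c hK₁S
    (fun z hz => mem_image_of_mem G₁ hz) (hcu.mono hρcρ)
  obtain ⟨hTv, hevv⟩ := tendstoUniformlyOn_chart_of_isEmbedding hι hSo hφc hK₂c hK₂S
    (fun z hz => mem_image_of_mem G₂ hz) (hcv.mono hρcρ)
  -- eventually the regular-branch approximants stay where `Jg = Jc`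
  have hevJ : ∀ᶠ n in atTop, ∀ z ∈ closedBall (0 : ℂ) ρc, φ (v n z) ∈ ball y₀ rJ := by
    have hc : IsCompact (g₂ '' closedBall (0 : ℂ) ρc) :=
      (isCompact_closedBall 0 ρc).image_of_continuousOn
        (hg₂s.continuousOn.mono (hρcR.trans hRa))
    have hsub : g₂ '' closedBall (0 : ℂ) ρc ⊆ ball y₀ rJ := by
      rintro _ ⟨z, hz, rfl⟩
      exact (hRJ z (hρcR hz)).2
    exact eventually_mem_of_tendstoUniformlyOn hc isOpen_ball hsub
      (fun z hz => mem_image_of_mem g₂ hz) hTv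
  obtain ⟨N₀, hN₀⟩ := eventually_atTop.1 (hevu.and (hevv.and hevJ))
  -- the shifted chart representatives of the approximants
  set u' : ℕ → ℂ → EuclideanSpace ℝ (Fin 4) := fun k z => φ (u (k + N₀) z) with hu'_def
  set w' : ℕ → ℂ → EuclideanSpace ℝ (Fin 4) := fun k z => φ (v (k + N₀) z) with hw'_def
  have huS : ∀ k, ∀ z ∈ closedBall (0 : ℂ) ρc, u (k + N₀) z ∈ S := fun k z hz =>
    (hN₀ (k + N₀) (Nat.le_add_left N₀ k)).1 z hz
  have hvS : ∀ k, ∀ z ∈ closedBall (0 : ℂ) ρc, v (k + N₀) z ∈ S := fun k z hz =>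
    (hN₀ (k + N₀) (Nat.le_add_left N₀ k)).2.1 z hz
  have hvJr : ∀ k, ∀ z ∈ closedBall (0 : ℂ) ρc, φ (v (k + N₀) z) ∈ ball y₀ rJ := fun k z hz =>
    (hN₀ (k + N₀) (Nat.le_add_left N₀ k)).2.2 z hz
  have hu' : ∀ k, ContinuousOn (u' k) (ball 0 ρc) := fun k =>
    hφc.comp (hu (k + N₀)).continuous.continuousOn
      fun z hz => huS k z (ball_subset_closedBall hz)
  have hw' : ∀ k, ContDiffOn ℝ ∞ (w' k) (ball 0 ρc) := fun k z hz =>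
    (contDiffAt_chart (hv (k + N₀) z) (hvS k z (ball_subset_closedBall hz))).contDiffWithinAt
  have hw'J : ∀ k, ∀ z ∈ ball (0 : ℂ) ρc, ∀ ζ : ℂ,
      fderiv ℝ (w' k) z (Complex.I * ζ) = Jg (w' k z) (fderiv ℝ (w' k) z ζ) := by
    intro k z hz ζ
    have hzS := hvS k z (ball_subset_closedBall hz)
    rw [show w' k z = φ (v (k + N₀) z) from rfl, hJgc (hvJr k z (ball_subset_closedBall hz)),
      hJcJ _ hzS]
    exact fderiv_chart_I_mul J (hv (k + N₀) z) (hvJ (k + N₀) z) hzS ζ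
  have hul : TendstoLocallyUniformlyOn u' vg atTop (ball 0 ρc) := by
    have h1 : TendstoUniformlyOn u' g₁ atTop (closedBall 0 ρc) := fun s hs =>
      (tendsto_add_atTop_nat N₀).eventually (hTu s hs)
    exact ((h1.mono ball_subset_closedBall).congr_right
      fun z hz => (hvg₁ (hRv' (hρcR (ball_subset_closedBall hz)))).symm).tendstoLocallyUniformlyOn
  have hwl : TendstoLocallyUniformlyOn w' bg atTop (ball 0 ρc) := by
    have h1 : TendstoUniformlyOn w' g₂ atTop (closedBall 0 ρc) := fun s hs =>
      (tendsto_add_atTop_nat N₀).eventually (hTv s hs)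
    exact ((h1.mono ball_subset_closedBall).congr_right
      fun z hz => (hbg₂ (hRb' (hρcR (ball_subset_closedBall hz)))).symm).tendstoLocallyUniformlyOn
  -- the generalized Weierstraß theorem: `C¹`-convergence of the regular-branch approximants
  obtain ⟨-, -, hdwl⟩ := hW Jg hJg hJg2 (ball 0 ρc) isOpen_ball w' bg hw' hw'J hwl
  -- the flat persistence theorem
  have h4 : Module.finrank ℝ (EuclideanSpace ℝ (Fin 4)) = 4 := by simp
  have hflat := isolatedIntersection_persists_flat h4 hJg hR hR hbg hbJ' hJ2' hinj' hvg hvJ' hx'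
    hρi hiso' isOpen_ball (mem_ball_self hρc) hu' hw' hul hwl hdwl hρc
  -- back to the manifold: `φ` is injective on the chart domain
  have hmain : ∀ᶠ k in atTop, ∃ s ∈ ball (0 : ℂ) ρ, ∃ t ∈ ball (0 : ℂ) ρ,
      u (k + N₀) s = v (k + N₀) t := by
    filter_upwards [hflat] with k ⟨s, hs, t, ht, hst⟩
    have hs' : s ∈ closedBall (0 : ℂ) ρc := ball_subset_closedBall hs
    have ht' : t ∈ closedBall (0 : ℂ) ρc := ball_subset_closedBall ht
    exact ⟨s, ball_subset_ball hρcρ'.le hs, t, ball_subset_ball hρcρ'.le ht,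
      hφinj (huS k s hs') (hvS k t ht') hst⟩
  obtain ⟨K₀, hK₀⟩ := eventually_atTop.1 hmain
  refine eventually_atTop.2 ⟨K₀ + N₀, fun n hn => ?_⟩
  have h := hK₀ (n - N₀) (by omega)
  rwa [Nat.sub_add_cancel (by omega)] at h

/-- **Positivity of intersections, persistence form (McDuff 1991, Thm 1.1 with §5 (5.1) cases
(i)–(ii), Lemma 4.2(ii)): the named fact `jHolomorphic_isolatedIntersection_persists` holds.** An
isolated intersection of two smooth `J`-holomorphic branches in an almost complex `4`-manifold,
one of them regular at the point, persists under `C⁰`-small perturbation by `J`-holomorphic maps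
(from `jHolomorphic_isolatedIntersection_persists_of_weierstrass` and the generalized Weierstraß
theorem `JHolomorphicWeierstrassR4_holds`, Hummel 1997 III.3.1).
[cite: McDuff1991LocalBehaviour, Thm 1.1, §5 (5.1)(i)-(ii), Lemma 4.2(ii)] -/
theorem jHolomorphic_isolatedIntersection_persists_holds :
    jHolomorphic_isolatedIntersection_persists :=
  jHolomorphic_isolatedIntersection_persists_of_weierstrass JHolomorphicWeierstrassR4_holds

end Literature.Geometry.Symplectic

end
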